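import Literature.NumberTheory.Automorphic.WhittakerTorusJacquetGL2
import Literature.NumberTheory.Automorphic.OpenCellCoinvariants
import Literature.NumberTheory.Automorphic.ParabolicGLExactProofs
import Literature.NumberTheory.Automorphic.IwasawaDecompositionGL
import HarnessLib

/-!
# The Jacquet module of the principal series of `GL₂(F)`: dimension, exponents, spherical vector

Topic `Literature/NumberTheory/Automorphic`; proof file (theorems only).  Let `F` be a
non-archimedean local field, `B = P_id ≤ GL₂(F)` the upper Borel subgroup, `T = Π_a GL₁(F)` its
Levi quotient, `N = U₂` its unipotent radical, and `σ` a smooth representation of `T` on a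
finite-dimensional space `W` (a character when `dim W = 1`).  The normalised principal series is
`I(σ) = Ind_B^{GL₂} (σ ∘ proj ⊗ δ_B^{1/2})` (`Representation.parabolicIndGL F id σ`) and its
Jacquet module is `I(σ)_N` (the `U_id`-coinvariants `(restrictUnipotentGL F id (I σ)).Coinvariants`).
We prove the `GL₂` case of the geometric lemma (Bernstein–Zelevinsky 1977, Thm. 5.2, for the two
`(B, B)`-double cosets `B` and `B w₀ N`; Bump 1997, Prop. 4.5.? / Thm. 4.5.4 context; Godement
1970, §1.7; Casselman 1995, Thm. 6.3.5) as UPPER BOUNDS, without Haar measure: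

* `finiteDimensional_coinvariants_parabolicIndGL_fin_two`: `I(σ)_N` is finite-dimensional and
  `dim I(σ)_N ≤ 2 · dim W`.  Evaluation at `1` kills `N` and descends to `ev̄ : I(σ)_N → W`; its
  kernel consists of the classes of functions vanishing on the closed cell `B` (`cellLT id w₀`),
  which by `mk_mem_span_range_mk_cellSection` (the open-orbit term, `OpenCellCoinvariants`) lie
  in the span of the classes of the standard sections `Φ_{K₀,w}` (`cellSection`), `w ∈ W`.
* the closed-cell exponent `ev₁ (I(p) f) = (σ ∘ proj ⊗ δ^{1/2})(p) (ev₁ f)` for `p ∈ B`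
  (`toFun_one_parabolicIndGL_parabolic`) and the open-cell exponent
  `I(d(u,1)) Φ_{K₀,w} = Φ_{K₀, (σ∘proj ⊗ δ^{1/2})(d(1,u)) w}` for `|u| = 1` and `K₀ = N(𝒪)`
  (`parabolicIndGL_diagGL2_cellSection`): the torus `d(𝒪ˣ, 1)` acts on the two exponents through
  the FIRST, resp. the SECOND, coordinate of `σ`;
* `forall_apply_leviProjection_eq_of_jacquetGL_diagGL2_eq` (**unramified exponents**): if
  `dim I(σ)_N = 2 · dim W`, `W ≠ 0`, `σ` acts by scalars, and `d(u, 1)` (`|u| = 1`) acts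
  trivially on `I(σ)_N`, then `σ(proj d(u,1)) = σ(proj d(1,u)) = 1`;
* `exists_mem_fixedPoints_glInt_parabolicIndGL_fin_two` (**the spherical vector**): if
  `σ ∘ proj` is trivial on `B ∩ GL₂(𝒪)` then `I(σ)` has a non-zero `GL₂(𝒪)`-fixed vector
  (`f₀(bk) = (σ∘proj ⊗ δ^{1/2})(b) w`, Iwasawa decomposition `exists_borel_mul_glInt`).

These are the local inputs of Step B/D/E of the classification-free proof that a generic
irreducible representation of `GL₂(F)` with `deg L(s, π) = 2` is spherical
(`WhittakerTorusJacquetGL2` for Step C).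

## References

* I. N. Bernstein, A. V. Zelevinsky, *Induced representations of reductive `p`-adic groups I*,
  Ann. Sci. ÉNS 10 (1977), Thm. 5.2 (geometric lemma), §2. [BernsteinZelevinskyASENS1977]
* W. Casselman, *Introduction to the theory of admissible representations of `p`-adic reductive
  groups* (1995), Thm. 6.3.5, Prop. 6.2.1 ff. [Casselman1995]
* D. Bump, *Automorphic forms and representations* (1997), §4.5–4.6. [Bump1997]
* H. Jacquet, R. P. Langlands, *Automorphic forms on GL(2)*, LNM 114 (1970), §3. [JacquetLanglands1970]
-/

noncomputable section

open scoped MatrixGroups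
open ValuativeRel

namespace Literature.NumberTheory.Automorphic

variable {F : Type*} [Field F] [ValuativeRel F] [TopologicalSpace F] [IsNonarchimedeanLocalField F]

/-! ### Part 1: the two `(B, N)`-cells of `GL₂` -/

omit [ValuativeRel F] [TopologicalSpace F] [IsNonarchimedeanLocalField F] in
/-- `S₂ = {1, w₀}`. [folklore] -/
theorem perm_fin_two_eq (τ : Equiv.Perm (Fin 2)) : τ = 1 ∨ τ = Fin.revPerm := by
  revert τ
  decide

omit [ValuativeRel F] [TopologicalSpace F] [IsNonarchimedeanLocalField F] in
/-- **The closed cell of `GL₂` is the Borel**: `cellLT id w₀ ⊆ B`. [folklore] -/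
theorem mem_standardParabolicGL_of_mem_cellLT {g : GL (Fin 2) F}
    (hg : g ∈ cellLT (K := F) (id : Fin 2 → Fin 2) Fin.revPerm) :
    g ∈ standardParabolicGL F (id : Fin 2 → Fin 2) := by
  obtain ⟨τ, hτ, p, hp, u, hu, rfl⟩ := hg
  rcases perm_fin_two_eq τ with rfl | rfl
  · rw [permGL_one, mul_one]
    exact Subgroup.mul_mem _ hp (unipotentRadicalGL_le F (id : Fin 2 → Fin 2) hu)
  · exact absurd (Set.mem_Iio.1 hτ) (lt_irrefl _)

/-! ### Part 2: the principal series of `GL₂` — evaluation at `1` -/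

section PrincipalSeries

variable {W : Type*} [AddCommGroup W] [Module ℂ W]
  (σ : Representation ℂ (Π a, GL {i // (id : Fin 2 → Fin 2) i = a} F) W)

-- Notation used in the docstrings: `B = standardParabolicGL F id`, `τ_σ = σ ∘ proj ⊗ δ_B^{1/2}`,
-- `I(σ) = parabolicIndGL F id σ`, `I(σ)_N` its `U_id`-coinvariants, `[f]` the class of `f`.

/-- A function of `Ind_B^{GL₂}` vanishing at `1` vanishes on the closed cell. [folklore] -/
theorem mem_vanishingOn_cellLT_of_toFun_one_eq_zero
    {τ' : Representation ℂ ↥(standardParabolicGL F (id : Fin 2 → Fin 2)) W} (f : Representation.SmoothInd (standardParabolicGL F (id : Fin 2 → Fin 2)) τ') (hf : f.toFun 1 = 0) :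
    f ∈ vanishingOn (standardParabolicGL F (id : Fin 2 → Fin 2)) τ' (cellLT (K := F) (id : Fin 2 → Fin 2) Fin.revPerm) := by
  intro g hg
  have hgP := mem_standardParabolicGL_of_mem_cellLT hg
  rw [show g = ((⟨g, hgP⟩ : ↥(standardParabolicGL F (id : Fin 2 → Fin 2))) : GL (Fin 2) F) * 1 from (mul_one g).symm,
    Representation.SmoothInd.toFun_subgroup_mul, hf, map_zero]

/-- `(σ ∘ proj ⊗ δ^{1/2})(u) = 1` on `W` for `u ∈ N`. [folklore] -/
theorem twist_comp_leviProjection_apply_of_mem_unipotentRadicalP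
    (u : ↥(unipotentRadicalP F (id : Fin 2 → Fin 2))) (w : W) : (Representation.twist (MonoidHom.comp σ (leviProjection F (id : Fin 2 → Fin 2))) (rootDeltaChar (standardParabolicGL F (id : Fin 2 → Fin 2)))) (u : ↥(standardParabolicGL F (id : Fin 2 → Fin 2))) w = w := by
  rw [Representation.twist_apply, rootDeltaChar_eq_one_of_mem_unipotentRadicalP F (id : Fin 2 → Fin 2) u.2,
    Units.val_one, one_smul, MonoidHom.comp_apply, (MonoidHom.mem_ker).1 u.2, map_one, Module.End.one_apply]

/-- **Evaluation at `1` kills `N`**: `(I(u) f)(1) = f(1)` for `u ∈ N`. [folklore] -/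
theorem toFun_one_parabolicIndGL_unipotent (u : ↥(unipotentRadicalP F (id : Fin 2 → Fin 2)))
    (f : Representation.SmoothInd (standardParabolicGL F (id : Fin 2 → Fin 2)) (Representation.twist (MonoidHom.comp σ (leviProjection F (id : Fin 2 → Fin 2))) (rootDeltaChar (standardParabolicGL F (id : Fin 2 → Fin 2))))) :
    ((Representation.parabolicIndGL F (id : Fin 2 → Fin 2) σ) ((u : ↥(standardParabolicGL F (id : Fin 2 → Fin 2))) : GL (Fin 2) F) f).toFun 1 = f.toFun 1 := by
  change (Representation.smoothIndRep (standardParabolicGL F (id : Fin 2 → Fin 2)) (Representation.twist (MonoidHom.comp σ (leviProjection F (id : Fin 2 → Fin 2))) (rootDeltaChar (standardParabolicGL F (id : Fin 2 → Fin 2)))) ((u : ↥(standardParabolicGL F (id : Fin 2 → Fin 2))) : GL (Fin 2) F) f).toFun 1 = _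
  rw [Representation.toFun_smoothIndRep_apply, one_mul, ← mul_one ((u : ↥(standardParabolicGL F (id : Fin 2 → Fin 2))) : GL (Fin 2) F),
    Representation.SmoothInd.toFun_subgroup_mul, twist_comp_leviProjection_apply_of_mem_unipotentRadicalP]

/-- **The closed-cell exponent**: `(I(p) f)(1) = (σ ∘ proj ⊗ δ^{1/2})(p) (f(1))` for `p ∈ B`.
[folklore] -/
theorem toFun_one_parabolicIndGL_parabolic (p : ↥(standardParabolicGL F (id : Fin 2 → Fin 2))) (f : Representation.SmoothInd (standardParabolicGL F (id : Fin 2 → Fin 2)) (Representation.twist (MonoidHom.comp σ (leviProjection F (id : Fin 2 → Fin 2))) (rootDeltaChar (standardParabolicGL F (id : Fin 2 → Fin 2))))) :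
    ((Representation.parabolicIndGL F (id : Fin 2 → Fin 2) σ) (p : GL (Fin 2) F) f).toFun 1 = (Representation.twist (MonoidHom.comp σ (leviProjection F (id : Fin 2 → Fin 2))) (rootDeltaChar (standardParabolicGL F (id : Fin 2 → Fin 2)))) p (f.toFun 1) := by
  change (Representation.smoothIndRep (standardParabolicGL F (id : Fin 2 → Fin 2)) (Representation.twist (MonoidHom.comp σ (leviProjection F (id : Fin 2 → Fin 2))) (rootDeltaChar (standardParabolicGL F (id : Fin 2 → Fin 2)))) (p : GL (Fin 2) F) f).toFun 1 = _
  rw [Representation.toFun_smoothIndRep_apply, one_mul, ← mul_one (p : GL (Fin 2) F),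
    Representation.SmoothInd.toFun_subgroup_mul]

/-- Unfolding: `I(σ) = Ind_B (σ ∘ proj ⊗ δ^{1/2})` on the nose. [folklore] -/
theorem parabolicIndGL_fin_two_apply (g : GL (Fin 2) F) (f : Representation.SmoothInd (standardParabolicGL F (id : Fin 2 → Fin 2)) (Representation.twist (MonoidHom.comp σ (leviProjection F (id : Fin 2 → Fin 2))) (rootDeltaChar (standardParabolicGL F (id : Fin 2 → Fin 2))))) :
    (Representation.parabolicIndGL F (id : Fin 2 → Fin 2) σ) g f = Representation.smoothIndRep (standardParabolicGL F (id : Fin 2 → Fin 2)) (Representation.twist (MonoidHom.comp σ (leviProjection F (id : Fin 2 → Fin 2))) (rootDeltaChar (standardParabolicGL F (id : Fin 2 → Fin 2)))) g f := rfl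

/-- Unfolding: the restriction to `N` acts by `I(u)`. [folklore] -/
theorem restrictUnipotentGL_parabolicIndGL_fin_two_apply (u : ↥(unipotentRadicalP F (id : Fin 2 → Fin 2)))
    (f : Representation.SmoothInd (standardParabolicGL F (id : Fin 2 → Fin 2)) (Representation.twist (MonoidHom.comp σ (leviProjection F (id : Fin 2 → Fin 2))) (rootDeltaChar (standardParabolicGL F (id : Fin 2 → Fin 2))))) :
    Representation.restrictUnipotentGL F (id : Fin 2 → Fin 2) (Representation.parabolicIndGL F (id : Fin 2 → Fin 2) σ) u f =
      Representation.smoothIndRep (standardParabolicGL F (id : Fin 2 → Fin 2)) (Representation.twist (MonoidHom.comp σ (leviProjection F (id : Fin 2 → Fin 2))) (rootDeltaChar (standardParabolicGL F (id : Fin 2 → Fin 2)))) ((u : ↥(standardParabolicGL F (id : Fin 2 → Fin 2))) : GL (Fin 2) F) f := rfl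

/-- Equal classes in the Jacquet module have equal values at `1`. [folklore] -/
theorem toFun_one_eq_of_mk_eq {f g : Representation.SmoothInd (standardParabolicGL F (id : Fin 2 → Fin 2)) (Representation.twist (MonoidHom.comp σ (leviProjection F (id : Fin 2 → Fin 2))) (rootDeltaChar (standardParabolicGL F (id : Fin 2 → Fin 2))))} (h : (Representation.Coinvariants.mk (Representation.restrictUnipotentGL F (id : Fin 2 → Fin 2) (Representation.parabolicIndGL F (id : Fin 2 → Fin 2) σ))) f = (Representation.Coinvariants.mk (Representation.restrictUnipotentGL F (id : Fin 2 → Fin 2) (Representation.parabolicIndGL F (id : Fin 2 → Fin 2) σ))) g) :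
    f.toFun 1 = g.toFun 1 := by
  -- the evaluation functional
  let ev : Representation.SmoothInd (standardParabolicGL F (id : Fin 2 → Fin 2)) (Representation.twist (MonoidHom.comp σ (leviProjection F (id : Fin 2 → Fin 2))) (rootDeltaChar (standardParabolicGL F (id : Fin 2 → Fin 2)))) →ₗ[ℂ] W :=
    { toFun := fun f => f.toFun 1
      map_add' := fun f g => by rw [Representation.SmoothInd.toFun_add, Pi.add_apply]
      map_smul' := fun c f => by rw [Representation.SmoothInd.toFun_smul, Pi.smul_apply, RingHom.id_apply] }
  have hker : Representation.Coinvariants.ker (Representation.restrictUnipotentGL F (id : Fin 2 → Fin 2) (Representation.parabolicIndGL F (id : Fin 2 → Fin 2) σ)) ≤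
      LinearMap.ker ev := by
    rw [Representation.Coinvariants.ker, Submodule.span_le]
    rintro _ ⟨⟨u, x⟩, rfl⟩
    rw [SetLike.mem_coe, LinearMap.mem_ker, map_sub, sub_eq_zero]
    exact toFun_one_parabolicIndGL_unipotent σ u x
  have h' : f - g ∈ LinearMap.ker ev := hker ((Representation.Coinvariants.mk_eq_iff _).1 h)
  rwa [LinearMap.mem_ker, map_sub, sub_eq_zero] at h'

/-! ### Part 3: the Jacquet module of `I(σ)` is at most `2 · dim W`-dimensional -/

/-- The compact open subgroup `K₀ = N'(𝒪) = N' ∩ GL₂(𝒪)` of the opposite-cell radical `N'`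
(here `N' = N`): open and compact. [folklore] -/
theorem isOpen_isCompact_comap_glInt_oppositeCellRadical :
    IsOpen (((glInt 2 F).comap (oppositeCellRadical (K := F) (id : Fin 2 → Fin 2)).subtype :
      Subgroup ↥(oppositeCellRadical (K := F) (id : Fin 2 → Fin 2))) :
        Set ↥(oppositeCellRadical (K := F) (id : Fin 2 → Fin 2))) ∧
    IsCompact (((glInt 2 F).comap (oppositeCellRadical (K := F) (id : Fin 2 → Fin 2)).subtype :
      Subgroup ↥(oppositeCellRadical (K := F) (id : Fin 2 → Fin 2))) :
        Set ↥(oppositeCellRadical (K := F) (id : Fin 2 → Fin 2))) :=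
  ⟨(isOpen_glInt 2 F).preimage continuous_subtype_val,
    (isClosed_oppositeCellRadical (c := (id : Fin 2 → Fin 2))).isClosedEmbedding_subtypeVal.isCompact_preimage
      (isCompact_glInt 2 F)⟩

set_option maxHeartbeats 1600000 in
/-- **The classes of functions vanishing at `1` lie in the span of the classes of the standard
sections** `Φ_{K₀,w}`, `w ∈ W` (the open-orbit term of the geometric lemma as an upper bound:
`mk_mem_span_range_mk_cellSection` with the trivial character). [cite: BernsteinZelevinskyASENS1977, Thm. 5.2] -/
theorem mk_mem_range_of_toFun_one_eq_zero (hσ : σ.IsSmooth)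
    (K₀ : Subgroup ↥(oppositeCellRadical (K := F) (id : Fin 2 → Fin 2)))
    (hK₀o : IsOpen (K₀ : Set ↥(oppositeCellRadical (K := F) (id : Fin 2 → Fin 2))))
    (hK₀c : IsCompact (K₀ : Set ↥(oppositeCellRadical (K := F) (id : Fin 2 → Fin 2))))
    (f : Representation.SmoothInd (standardParabolicGL F (id : Fin 2 → Fin 2)) (Representation.twist (MonoidHom.comp σ (leviProjection F (id : Fin 2 → Fin 2))) (rootDeltaChar (standardParabolicGL F (id : Fin 2 → Fin 2))))) (hf : f.toFun 1 = 0) :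
    (Representation.Coinvariants.mk (Representation.restrictUnipotentGL F (id : Fin 2 → Fin 2) (Representation.parabolicIndGL F (id : Fin 2 → Fin 2) σ))) f ∈ LinearMap.range ((Representation.Coinvariants.mk (Representation.restrictUnipotentGL F (id : Fin 2 → Fin 2) (Representation.parabolicIndGL F (id : Fin 2 → Fin 2) σ))) ∘ₗ
      cellSectionₗ (Representation.twist (MonoidHom.comp σ (leviProjection F (id : Fin 2 → Fin 2))) (rootDeltaChar (standardParabolicGL F (id : Fin 2 → Fin 2)))) monotone_id (hσ.twist_comp_leviProjection F (id : Fin 2 → Fin 2)) K₀ hK₀o hK₀c) := by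
  have hτs := hσ.twist_comp_leviProjection F (id : Fin 2 → Fin 2)
  have hfv := mem_vanishingOn_cellLT_of_toFun_one_eq_zero f hf
  have hθ : ∀ x ∈ K₀, whittakerCharFun (1 : AddChar F Circle) (radicalToUpper (c := (id : Fin 2 → Fin 2))
      monotone_id x) = 1 := fun x _ => by
    rw [whittakerCharFun_apply, AddChar.one_apply, Circle.coe_one]
  have hspan := mk_mem_span_range_mk_cellSection (σ' := (Representation.twist (MonoidHom.comp σ (leviProjection F (id : Fin 2 → Fin 2))) (rootDeltaChar (standardParabolicGL F (id : Fin 2 → Fin 2))))) (1 : AddChar F Circle) monotone_id hτs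
    K₀ hK₀o hK₀c hθ f hfv
  -- the comparison map from the `ψ = 1`-twisted coinvariants of `I_open` to the Jacquet module
  set ρO := (openCellSubrep (id : Fin 2 → Fin 2) (Representation.twist (MonoidHom.comp σ (leviProjection F (id : Fin 2 → Fin 2))) (rootDeltaChar (standardParabolicGL F (id : Fin 2 → Fin 2)))) (1 : AddChar F Circle)).toRepresentation with hρO
  have hcomp : ∀ u : ↥(upperUnitriangular (Fin 2) F),
      ((Representation.Coinvariants.mk (Representation.restrictUnipotentGL F (id : Fin 2 → Fin 2) (Representation.parabolicIndGL F (id : Fin 2 → Fin 2) σ))) ∘ₗ (openCellSubrep (id : Fin 2 → Fin 2) (Representation.twist (MonoidHom.comp σ (leviProjection F (id : Fin 2 → Fin 2))) (rootDeltaChar (standardParabolicGL F (id : Fin 2 → Fin 2)))) (1 : AddChar F Circle)).toSubmodule.subtype) ∘ₗ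
        ρO u =
      (Representation.Coinvariants.mk (Representation.restrictUnipotentGL F (id : Fin 2 → Fin 2) (Representation.parabolicIndGL F (id : Fin 2 → Fin 2) σ))) ∘ₗ (openCellSubrep (id : Fin 2 → Fin 2) (Representation.twist (MonoidHom.comp σ (leviProjection F (id : Fin 2 → Fin 2))) (rootDeltaChar (standardParabolicGL F (id : Fin 2 → Fin 2)))) (1 : AddChar F Circle)).toSubmodule.subtype := by
    intro u
    refine LinearMap.ext fun x => ?_
    obtain ⟨u', hu', hu'u⟩ := Subgroup.mem_map.1 u.2
    have hval : ((ρO u x : ↥(openCellSubrep (id : Fin 2 → Fin 2) (Representation.twist (MonoidHom.comp σ (leviProjection F (id : Fin 2 → Fin 2))) (rootDeltaChar (standardParabolicGL F (id : Fin 2 → Fin 2)))) (1 : AddChar F Circle)).toSubmodule) :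
        Representation.SmoothInd (standardParabolicGL F (id : Fin 2 → Fin 2)) (Representation.twist (MonoidHom.comp σ (leviProjection F (id : Fin 2 → Fin 2))) (rootDeltaChar (standardParabolicGL F (id : Fin 2 → Fin 2))))) =
        Representation.smoothIndRep (standardParabolicGL F (id : Fin 2 → Fin 2)) (Representation.twist (MonoidHom.comp σ (leviProjection F (id : Fin 2 → Fin 2))) (rootDeltaChar (standardParabolicGL F (id : Fin 2 → Fin 2)))) (u : GL (Fin 2) F) x := by
      change whittakerTwist (Representation.smoothIndRep (standardParabolicGL F (id : Fin 2 → Fin 2)) (Representation.twist (MonoidHom.comp σ (leviProjection F (id : Fin 2 → Fin 2))) (rootDeltaChar (standardParabolicGL F (id : Fin 2 → Fin 2))))) (1 : AddChar F Circle) u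
        (x : Representation.SmoothInd (standardParabolicGL F (id : Fin 2 → Fin 2)) (Representation.twist (MonoidHom.comp σ (leviProjection F (id : Fin 2 → Fin 2))) (rootDeltaChar (standardParabolicGL F (id : Fin 2 → Fin 2))))) = _
      rw [whittakerTwist_apply, whittakerCharFun_apply, AddChar.one_apply, Circle.coe_one,
        inv_one, one_smul]
    simp only [LinearMap.coe_comp, Function.comp_apply, Submodule.coe_subtype]
    rw [hval]
    have hrel := Representation.Coinvariants.mk_self_apply
      (Representation.restrictUnipotentGL F (id : Fin 2 → Fin 2) (Representation.parabolicIndGL F (id : Fin 2 → Fin 2) σ)) ⟨u', hu'⟩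
      (x : Representation.SmoothInd (standardParabolicGL F (id : Fin 2 → Fin 2)) (Representation.twist (MonoidHom.comp σ (leviProjection F (id : Fin 2 → Fin 2))) (rootDeltaChar (standardParabolicGL F (id : Fin 2 → Fin 2)))))
    rw [restrictUnipotentGL_parabolicIndGL_fin_two_apply] at hrel
    have hu'' : ((u' : ↥(standardParabolicGL F (id : Fin 2 → Fin 2))) : GL (Fin 2) F) = (u : GL (Fin 2) F) := hu'u
    rw [← hu'']
    exact hrel
  set Θ := Representation.Coinvariants.lift ρO
    ((Representation.Coinvariants.mk (Representation.restrictUnipotentGL F (id : Fin 2 → Fin 2) (Representation.parabolicIndGL F (id : Fin 2 → Fin 2) σ))) ∘ₗ (openCellSubrep (id : Fin 2 → Fin 2) (Representation.twist (MonoidHom.comp σ (leviProjection F (id : Fin 2 → Fin 2))) (rootDeltaChar (standardParabolicGL F (id : Fin 2 → Fin 2)))) (1 : AddChar F Circle)).toSubmodule.subtype) hcomp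
    with hΘ
  have hΘmk : ∀ y, Θ (Representation.Coinvariants.mk ρO y) = (Representation.Coinvariants.mk (Representation.restrictUnipotentGL F (id : Fin 2 → Fin 2) (Representation.parabolicIndGL F (id : Fin 2 → Fin 2) σ))) (y : Representation.SmoothInd (standardParabolicGL F (id : Fin 2 → Fin 2)) (Representation.twist (MonoidHom.comp σ (leviProjection F (id : Fin 2 → Fin 2))) (rootDeltaChar (standardParabolicGL F (id : Fin 2 → Fin 2))))) :=
    fun y => Representation.Coinvariants.lift_mk _ _ _ _
  have himg := Submodule.mem_map_of_mem (f := Θ) hspan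
  rw [hΘmk, Submodule.map_span, ← Set.range_comp] at himg
  refine (Submodule.span_le.2 ?_) himg
  rintro _ ⟨w, rfl⟩
  rw [SetLike.mem_coe, Function.comp_apply, hΘmk]
  exact LinearMap.mem_range.2 ⟨w, rfl⟩

/-- **Evaluation at `1` descends to the Jacquet module**: a linear map `ev̄ : I(σ)_N → W` with
`ev̄ [f] = f(1)`. [folklore] -/
theorem exists_coinvariants_eval :
    ∃ evJ : (Representation.restrictUnipotentGL F (id : Fin 2 → Fin 2) (Representation.parabolicIndGL F (id : Fin 2 → Fin 2) σ)).Coinvariants →ₗ[ℂ] W, ∀ f : Representation.SmoothInd (standardParabolicGL F (id : Fin 2 → Fin 2)) (Representation.twist (MonoidHom.comp σ (leviProjection F (id : Fin 2 → Fin 2))) (rootDeltaChar (standardParabolicGL F (id : Fin 2 → Fin 2)))), evJ ((Representation.Coinvariants.mk (Representation.restrictUnipotentGL F (id : Fin 2 → Fin 2) (Representation.parabolicIndGL F (id : Fin 2 → Fin 2) σ))) f) = f.toFun 1 := by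
  let ev : Representation.SmoothInd (standardParabolicGL F (id : Fin 2 → Fin 2)) (Representation.twist (MonoidHom.comp σ (leviProjection F (id : Fin 2 → Fin 2))) (rootDeltaChar (standardParabolicGL F (id : Fin 2 → Fin 2)))) →ₗ[ℂ] W :=
    { toFun := fun f => f.toFun 1
      map_add' := fun f g => by rw [Representation.SmoothInd.toFun_add, Pi.add_apply]
      map_smul' := fun c f => by rw [Representation.SmoothInd.toFun_smul, Pi.smul_apply, RingHom.id_apply] }
  have hcomp : ∀ u : ↥(unipotentRadicalP F (id : Fin 2 → Fin 2)),
      ev ∘ₗ Representation.restrictUnipotentGL F (id : Fin 2 → Fin 2) (Representation.parabolicIndGL F (id : Fin 2 → Fin 2) σ) u = ev := fun u =>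
    LinearMap.ext fun f => toFun_one_parabolicIndGL_unipotent σ u f
  exact ⟨Representation.Coinvariants.lift _ ev hcomp, fun f => Representation.Coinvariants.lift_mk _ _ _ _⟩

/-- **The kernel of `ev̄` is spanned by the classes of the standard sections.** [folklore] -/
theorem ker_eval_le_range (hσ : σ.IsSmooth)
    (K₀ : Subgroup ↥(oppositeCellRadical (K := F) (id : Fin 2 → Fin 2)))
    (hK₀o : IsOpen (K₀ : Set ↥(oppositeCellRadical (K := F) (id : Fin 2 → Fin 2))))
    (hK₀c : IsCompact (K₀ : Set ↥(oppositeCellRadical (K := F) (id : Fin 2 → Fin 2))))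
    {evJ : (Representation.restrictUnipotentGL F (id : Fin 2 → Fin 2) (Representation.parabolicIndGL F (id : Fin 2 → Fin 2) σ)).Coinvariants →ₗ[ℂ] W} (hevJ : ∀ f : Representation.SmoothInd (standardParabolicGL F (id : Fin 2 → Fin 2)) (Representation.twist (MonoidHom.comp σ (leviProjection F (id : Fin 2 → Fin 2))) (rootDeltaChar (standardParabolicGL F (id : Fin 2 → Fin 2)))), evJ ((Representation.Coinvariants.mk (Representation.restrictUnipotentGL F (id : Fin 2 → Fin 2) (Representation.parabolicIndGL F (id : Fin 2 → Fin 2) σ))) f) = f.toFun 1) :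
    LinearMap.ker evJ ≤ LinearMap.range ((Representation.Coinvariants.mk (Representation.restrictUnipotentGL F (id : Fin 2 → Fin 2) (Representation.parabolicIndGL F (id : Fin 2 → Fin 2) σ))) ∘ₗ
      cellSectionₗ (Representation.twist (MonoidHom.comp σ (leviProjection F (id : Fin 2 → Fin 2))) (rootDeltaChar (standardParabolicGL F (id : Fin 2 → Fin 2)))) monotone_id (hσ.twist_comp_leviProjection F (id : Fin 2 → Fin 2)) K₀ hK₀o hK₀c) := by
  intro x hx
  obtain ⟨f, rfl⟩ := Representation.Coinvariants.mk_surjective _ x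
  rw [LinearMap.mem_ker, hevJ] at hx
  exact mk_mem_range_of_toFun_one_eq_zero σ hσ K₀ hK₀o hK₀c f hx

/-- **The Jacquet module of the principal series of `GL₂` is finite-dimensional, of dimension at
most `2 · dim W`** (the `GL₂` geometric lemma as an upper bound: the closed cell contributes a
quotient of `I(σ)_N` embedding into `W` by evaluation at `1`, the open cell a subspace spanned by
the classes of `Φ_{K₀,w}`, `w ∈ W`).  (Bernstein–Zelevinsky 1977, Thm. 5.2; Casselman 1995,
Thm. 6.3.5; Bump 1997, §4.5.) [cite: BernsteinZelevinskyASENS1977, Thm. 5.2] -/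
theorem finiteDimensional_coinvariants_parabolicIndGL_fin_two [FiniteDimensional ℂ W]
    (hσ : σ.IsSmooth) :
    FiniteDimensional ℂ (Representation.restrictUnipotentGL F (id : Fin 2 → Fin 2) (Representation.parabolicIndGL F (id : Fin 2 → Fin 2) σ)).Coinvariants ∧ Module.finrank ℂ (Representation.restrictUnipotentGL F (id : Fin 2 → Fin 2) (Representation.parabolicIndGL F (id : Fin 2 → Fin 2) σ)).Coinvariants ≤ 2 * Module.finrank ℂ W := by
  obtain ⟨hK₀o, hK₀c⟩ := isOpen_isCompact_comap_glInt_oppositeCellRadical (F := F)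
  obtain ⟨evJ, hevJ⟩ := exists_coinvariants_eval σ
  have hkerS := ker_eval_le_range σ hσ _ hK₀o hK₀c hevJ
  haveI : FiniteDimensional ℂ (LinearMap.range ((Representation.Coinvariants.mk (Representation.restrictUnipotentGL F (id : Fin 2 → Fin 2) (Representation.parabolicIndGL F (id : Fin 2 → Fin 2) σ))) ∘ₗ cellSectionₗ (Representation.twist (MonoidHom.comp σ (leviProjection F (id : Fin 2 → Fin 2))) (rootDeltaChar (standardParabolicGL F (id : Fin 2 → Fin 2)))) monotone_id
      (hσ.twist_comp_leviProjection F (id : Fin 2 → Fin 2)) _ hK₀o hK₀c)) :=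
    LinearMap.finiteDimensional_range _
  haveI hkerfd : FiniteDimensional ℂ (LinearMap.ker evJ) := Submodule.finiteDimensional_of_le hkerS
  haveI : FiniteDimensional ℂ ((Representation.restrictUnipotentGL F (id : Fin 2 → Fin 2) (Representation.parabolicIndGL F (id : Fin 2 → Fin 2) σ)).Coinvariants ⧸ LinearMap.ker evJ) :=
    Module.Finite.equiv (LinearMap.quotKerEquivRange evJ).symm
  have hfd : FiniteDimensional ℂ (Representation.restrictUnipotentGL F (id : Fin 2 → Fin 2) (Representation.parabolicIndGL F (id : Fin 2 → Fin 2) σ)).Coinvariants := Module.Finite.of_submodule_quotient (LinearMap.ker evJ)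
  refine ⟨hfd, ?_⟩
  have h1 := LinearMap.finrank_range_add_finrank_ker evJ
  have h2 : Module.finrank ℂ (LinearMap.range evJ) ≤ Module.finrank ℂ W := Submodule.finrank_le _
  have h3 := Submodule.finrank_mono hkerS
  have h4 : Module.finrank ℂ (LinearMap.range ((Representation.Coinvariants.mk (Representation.restrictUnipotentGL F (id : Fin 2 → Fin 2) (Representation.parabolicIndGL F (id : Fin 2 → Fin 2) σ))) ∘ₗ cellSectionₗ (Representation.twist (MonoidHom.comp σ (leviProjection F (id : Fin 2 → Fin 2))) (rootDeltaChar (standardParabolicGL F (id : Fin 2 → Fin 2)))) monotone_id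
      (hσ.twist_comp_leviProjection F (id : Fin 2 → Fin 2)) _ hK₀o hK₀c)) ≤ Module.finrank ℂ W :=
    LinearMap.finrank_range_le _
  omega

/-! ### Part 4: the torus on the open cell — `I(d(u,1)) Φ_{K₀,w} = Φ_{K₀, (σ∘proj⊗δ^{1/2})(d(1,u)) w}` -/

omit [ValuativeRel F] [TopologicalSpace F] [IsNonarchimedeanLocalField F] in
/-- Diagonal matrices are block triangular for every labelling. [folklore] -/
theorem diagGL2_mem_standardParabolicGL_of_labelling {α : Type*} [LinearOrder α] (c' : Fin 2 → α) (a b : Fˣ) :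
    diagGL2 a b ∈ standardParabolicGL F c' := by
  rw [mem_standardParabolicGL_iff, coe_diagGL2]
  intro i j hij
  have hne : i ≠ j := fun h => by subst h; exact lt_irrefl _ hij
  fin_cases i <;> fin_cases j
  · exact absurd rfl hne
  · simp
  · simp
  · exact absurd rfl hne

omit [ValuativeRel F] [TopologicalSpace F] [IsNonarchimedeanLocalField F] in
/-- `w₀ d(a, b) = d(b, a) w₀`. [folklore] -/
theorem permGL_revPerm_mul_diagGL2 (a b : Fˣ) :
    (permGL Fin.revPerm : GL (Fin 2) F) * diagGL2 a b = diagGL2 b a * permGL Fin.revPerm := by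
  have h0 : (Fin.revPerm : Equiv.Perm (Fin 2)) 0 = 1 := by decide
  have h1 : (Fin.revPerm : Equiv.Perm (Fin 2)) 1 = 0 := by decide
  refine Units.ext ?_
  rw [Units.val_mul, Units.val_mul, coe_permGL, coe_diagGL2, coe_diagGL2]
  ext i j
  fin_cases i <;> fin_cases j <;>
    simp [Matrix.mul_apply, Fin.sum_univ_two, h0, h1]

omit [ValuativeRel F] [TopologicalSpace F] [IsNonarchimedeanLocalField F] in
/-- `d(a, b)⁻¹ = d(a⁻¹, b⁻¹)`. [folklore] -/
theorem diagGL2_inv_eq (a b : Fˣ) : (diagGL2 a b)⁻¹ = diagGL2 a⁻¹ b⁻¹ :=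
  inv_eq_of_mul_eq_one_right (by rw [← diagGL2_mul, mul_inv_cancel, mul_inv_cancel, diagGL2_one])

omit [TopologicalSpace F] [IsNonarchimedeanLocalField F] in
/-- `d(a, b) ∈ GL₂(𝒪)` for `|a| = |b| = 1`. [folklore] -/
theorem diagGL2_mem_glInt {a b : Fˣ} (ha : valuation F (a : F) = 1) (hb : valuation F (b : F) = 1) :
    diagGL2 a b ∈ glInt 2 F := by
  rw [mem_glInt_iff, diagGL2_inv_eq]
  refine ⟨fun i j => ?_, fun i j => ?_⟩ <;> rw [coe_diagGL2] <;> fin_cases i <;> fin_cases j <;>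
    simp [Valuation.mem_integer_iff, ha, hb]

omit [ValuativeRel F] [TopologicalSpace F] [IsNonarchimedeanLocalField F] in
/-- **The open cell is stable under right multiplication by the torus**:
`p w₀ n' · d = (p · w₀ d w₀⁻¹) w₀ (d⁻¹ n' d)`. [folklore] -/
theorem mul_diagGL2_mem_parabolicDoubleCoset_rev {g : GL (Fin 2) F}
    (hg : g ∈ parabolicDoubleCoset (K := F) (id : Fin 2 → Fin 2) Fin.revPerm) (a b : Fˣ) :
    g * diagGL2 a b ∈ parabolicDoubleCoset (K := F) (id : Fin 2 → Fin 2) Fin.revPerm := by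
  obtain ⟨p, hp, n', hn', rfl⟩ := (mem_parabolicDoubleCoset_rev_iff (id : Fin 2 → Fin 2) monotone_id g).1 hg
  have hd' : diagGL2 a b ∈ standardParabolicGL F (⇑OrderDual.toDual ∘ revLabel (id : Fin 2 → Fin 2)) :=
    diagGL2_mem_standardParabolicGL_of_labelling _ a b
  refine (mem_parabolicDoubleCoset_rev_iff _ monotone_id _).2 ⟨p * diagGL2 b a,
    Subgroup.mul_mem _ hp (diagGL2_mem_standardParabolicGL_of_labelling _ b a),
    (diagGL2 a b)⁻¹ * n' * diagGL2 a b, inv_mul_mul_mem_oppositeCellRadical_of_mem hd' hn', ?_⟩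
  calc p * permGL Fin.revPerm * n' * diagGL2 a b
      = p * (permGL Fin.revPerm * diagGL2 a b) * ((diagGL2 a b)⁻¹ * n' * diagGL2 a b) := by group
    _ = p * (diagGL2 b a * permGL Fin.revPerm) * ((diagGL2 a b)⁻¹ * n' * diagGL2 a b) := by
        rw [permGL_revPerm_mul_diagGL2]
    _ = p * diagGL2 b a * permGL Fin.revPerm * ((diagGL2 a b)⁻¹ * n' * diagGL2 a b) := by group

omit [ValuativeRel F] [TopologicalSpace F] [IsNonarchimedeanLocalField F] in
/-- Converse direction of `mul_diagGL2_mem_parabolicDoubleCoset_rev`. [folklore] -/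
theorem mem_parabolicDoubleCoset_rev_of_mul_diagGL2_mem {g : GL (Fin 2) F} {a b : Fˣ}
    (hg : g * diagGL2 a b ∈ parabolicDoubleCoset (K := F) (id : Fin 2 → Fin 2) Fin.revPerm) :
    g ∈ parabolicDoubleCoset (K := F) (id : Fin 2 → Fin 2) Fin.revPerm := by
  have h := mul_diagGL2_mem_parabolicDoubleCoset_rev hg a⁻¹ b⁻¹
  rwa [mul_assoc, ← diagGL2_mul, mul_inv_cancel, mul_inv_cancel, diagGL2_one, mul_one] at h

/-- **The open-cell exponent.**  For `|u| = 1` and `K₀ = N'(𝒪)` (the elements of the opposite-cell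
radical `N' = N` with integral entries), right translation by the torus element `d(u, 1)` carries
the standard section `Φ_{K₀,w}` to `Φ_{K₀, (σ ∘ proj ⊗ δ^{1/2})(d(1,u)) w}`:
`(I(d(u,1)) Φ)(p w₀ n') = Φ(p w₀ n' d(u,1)) = Φ((p d(1,u)) w₀ (d(u,1)⁻¹ n' d(u,1)))` and
`d(u,1)⁻¹ K₀ d(u,1) = K₀`.  So on the open-cell part of the Jacquet module `d(u,1)` acts through
the SECOND coordinate of `σ` (the exponent `χ^{w₀}` of the geometric lemma).
(Bernstein–Zelevinsky 1977, Thm. 5.2; Bump 1997, proof of Thm. 4.5.4 / Prop. 4.6.?; Godement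
1970, §1.7.) [cite: BernsteinZelevinskyASENS1977, Thm. 5.2] -/
theorem parabolicIndGL_diagGL2_cellSection (hσ : σ.IsSmooth)
    (K₀ : Subgroup ↥(oppositeCellRadical (K := F) (id : Fin 2 → Fin 2)))
    (hK₀ : ∀ x, x ∈ K₀ ↔ (x : GL (Fin 2) F) ∈ glInt 2 F)
    (hK₀o : IsOpen (K₀ : Set ↥(oppositeCellRadical (K := F) (id : Fin 2 → Fin 2))))
    (hK₀c : IsCompact (K₀ : Set ↥(oppositeCellRadical (K := F) (id : Fin 2 → Fin 2))))
    {u : Fˣ} (hu : valuation F (u : F) = 1) (w : W) :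
    (Representation.parabolicIndGL F (id : Fin 2 → Fin 2) σ) (diagGL2 u 1) (cellSection (Representation.twist (MonoidHom.comp σ (leviProjection F (id : Fin 2 → Fin 2))) (rootDeltaChar (standardParabolicGL F (id : Fin 2 → Fin 2)))) monotone_id (hσ.twist_comp_leviProjection F (id : Fin 2 → Fin 2))
      K₀ hK₀o hK₀c w) =
    cellSection (Representation.twist (MonoidHom.comp σ (leviProjection F (id : Fin 2 → Fin 2))) (rootDeltaChar (standardParabolicGL F (id : Fin 2 → Fin 2)))) monotone_id (hσ.twist_comp_leviProjection F (id : Fin 2 → Fin 2)) K₀ hK₀o hK₀c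
      ((Representation.twist (MonoidHom.comp σ (leviProjection F (id : Fin 2 → Fin 2))) (rootDeltaChar (standardParabolicGL F (id : Fin 2 → Fin 2)))) ⟨diagGL2 1 u, diagGL2_mem_standardParabolicGL_fin_two 1 u⟩ w) := by
  apply Representation.SmoothInd.ext
  funext g
  rw [parabolicIndGL_fin_two_apply, Representation.toFun_smoothIndRep_apply, toFun_cellSection,
    toFun_cellSection]
  have hdint : diagGL2 u 1 ∈ glInt 2 F := diagGL2_mem_glInt hu (by rw [Units.val_one, map_one])
  by_cases hg : g ∈ parabolicDoubleCoset (K := F) (id : Fin 2 → Fin 2) Fin.revPerm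
  · have hdec := openCellP_mul_w₀_mul_openCellN monotone_id hg
    have hp := openCellP_mem monotone_id hg
    have hn' := openCellN_mem monotone_id hg
    have hd'P : diagGL2 1 u ∈ (standardParabolicGL F (id : Fin 2 → Fin 2)) := diagGL2_mem_standardParabolicGL_fin_two 1 u
    have hdP' : diagGL2 u 1 ∈ standardParabolicGL F (⇑OrderDual.toDual ∘ revLabel (id : Fin 2 → Fin 2)) :=
      diagGL2_mem_standardParabolicGL_of_labelling _ u 1
    have hn'' : (diagGL2 u 1)⁻¹ * openCellN monotone_id hg * diagGL2 u 1 ∈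
        oppositeCellRadical (K := F) (id : Fin 2 → Fin 2) :=
      inv_mul_mul_mem_oppositeCellRadical_of_mem hdP' hn'
    have hgd : g * diagGL2 u 1 = openCellP monotone_id hg * diagGL2 1 u * permGL Fin.revPerm *
        ((diagGL2 u 1)⁻¹ * openCellN monotone_id hg * diagGL2 u 1) := by
      calc g * diagGL2 u 1 = openCellP monotone_id hg * permGL Fin.revPerm * openCellN monotone_id hg *
            diagGL2 u 1 := by rw [hdec]
        _ = openCellP monotone_id hg * (permGL Fin.revPerm * diagGL2 u 1) *
            ((diagGL2 u 1)⁻¹ * openCellN monotone_id hg * diagGL2 u 1) := by group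
        _ = openCellP monotone_id hg * (diagGL2 1 u * permGL Fin.revPerm) *
            ((diagGL2 u 1)⁻¹ * openCellN monotone_id hg * diagGL2 u 1) := by
            rw [permGL_revPerm_mul_diagGL2]
        _ = _ := by group
    have hmemiff : (⟨(diagGL2 u 1)⁻¹ * openCellN monotone_id hg * diagGL2 u 1, hn''⟩ :
          ↥(oppositeCellRadical (K := F) (id : Fin 2 → Fin 2))) ∈ K₀ ↔
        (⟨openCellN monotone_id hg, hn'⟩ : ↥(oppositeCellRadical (K := F) (id : Fin 2 → Fin 2))) ∈ K₀ := by
      rw [hK₀, hK₀]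
      change (diagGL2 u 1)⁻¹ * openCellN monotone_id hg * diagGL2 u 1 ∈ glInt 2 F ↔
        openCellN monotone_id hg ∈ glInt 2 F
      constructor
      · intro h
        have h' := Subgroup.mul_mem _ (Subgroup.mul_mem _ hdint h) (Subgroup.inv_mem _ hdint)
        rwa [show diagGL2 u 1 * ((diagGL2 u 1)⁻¹ * openCellN monotone_id hg * diagGL2 u 1) * (diagGL2 u 1)⁻¹ =
          openCellN monotone_id hg by group] at h'
      · intro h
        exact Subgroup.mul_mem _ (Subgroup.mul_mem _ (Subgroup.inv_mem _ hdint) h) hdint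
    rw [hgd]
    conv_rhs => rw [← hdec]
    by_cases hS : (⟨openCellN monotone_id hg, hn'⟩ : ↥(oppositeCellRadical (K := F) (id : Fin 2 → Fin 2))) ∈ K₀
    · rw [cellSectionFun_eq_of_mem monotone_id w (Subgroup.mul_mem _ hp hd'P) hn'' (hmemiff.2 hS),
        cellSectionFun_eq_of_mem monotone_id _ hp hn' hS, ← Module.End.mul_apply, ← map_mul]
      rfl
    · rw [cellSectionFun_eq_zero_of_not_mem monotone_id w (Subgroup.mul_mem _ hp hd'P) hn''
          (fun h => hS (hmemiff.1 h)),
        cellSectionFun_eq_zero_of_not_mem monotone_id _ hp hn' hS]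
  · have hgd : g * diagGL2 u 1 ∉ parabolicDoubleCoset (K := F) (id : Fin 2 → Fin 2) Fin.revPerm :=
      fun h => hg (mem_parabolicDoubleCoset_rev_of_mul_diagGL2_mem h)
    rw [cellSectionFun_of_not_mem monotone_id _ _ hgd, cellSectionFun_of_not_mem monotone_id _ _ hg]

/-! ### Part 5: unramified exponents -/

/-- **`δ_B^{1/2}` is trivial on `B ∩ GL₂(𝒪)`** (a compact open subgroup of `B`). [folklore] -/
theorem rootDeltaChar_standardParabolicGL_eq_one_of_mem_glInt (p : ↥(standardParabolicGL F (id : Fin 2 → Fin 2))) (hp : (p : GL (Fin 2) F) ∈ glInt 2 F) :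
    rootDeltaChar (standardParabolicGL F (id : Fin 2 → Fin 2)) p = 1 := by
  have hp' : p ∈ (glInt 2 F).comap ((MulAut.conj (1 : GL (Fin 2) F)).symm.toMonoidHom.comp
      (Subgroup.subtype (standardParabolicGL F (id : Fin 2 → Fin 2)))) := by
    rw [mem_comap_conj_symm_subtype, inv_one, one_mul, mul_one]
    exact hp
  have hmod : MeasureTheory.Measure.modularCharacter p = 1 :=
    modularCharacter_eq_one_of_mem_comap_conj (isClosed_standardParabolicGL F (id : Fin 2 → Fin 2))
      (isOpen_glInt 2 F) (isCompact_glInt 2 F) hp'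
  ext
  rw [rootDeltaChar_apply, hmod, NNReal.sqrt_one, Units.val_one, NNReal.coe_one, Complex.ofReal_one]

/-- **Evaluation at `1` is onto `W`**: the `w₀`-translate of `Φ_{K₀,w}` takes the value `w` at `1`.
[folklore] -/
theorem toFun_one_parabolicIndGL_permGL_cellSection (hσ : σ.IsSmooth)
    (K₀ : Subgroup ↥(oppositeCellRadical (K := F) (id : Fin 2 → Fin 2)))
    (hK₀o : IsOpen (K₀ : Set ↥(oppositeCellRadical (K := F) (id : Fin 2 → Fin 2))))
    (hK₀c : IsCompact (K₀ : Set ↥(oppositeCellRadical (K := F) (id : Fin 2 → Fin 2)))) (w : W) :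
    ((Representation.parabolicIndGL F (id : Fin 2 → Fin 2) σ) (permGL Fin.revPerm) (cellSection (Representation.twist (MonoidHom.comp σ (leviProjection F (id : Fin 2 → Fin 2))) (rootDeltaChar (standardParabolicGL F (id : Fin 2 → Fin 2)))) monotone_id
      (hσ.twist_comp_leviProjection F (id : Fin 2 → Fin 2)) K₀ hK₀o hK₀c w)).toFun 1 = w := by
  rw [parabolicIndGL_fin_two_apply, Representation.toFun_smoothIndRep_apply, one_mul, toFun_cellSection,
    show (permGL Fin.revPerm : GL (Fin 2) F) = 1 * permGL Fin.revPerm * 1 by rw [one_mul, mul_one],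
    cellSectionFun_eq_of_mem monotone_id w (Subgroup.one_mem _) (Subgroup.one_mem _) K₀.one_mem]
  change (Representation.twist (MonoidHom.comp σ (leviProjection F (id : Fin 2 → Fin 2))) (rootDeltaChar (standardParabolicGL F (id : Fin 2 → Fin 2)))) (1 : ↥(standardParabolicGL F (id : Fin 2 → Fin 2))) w = w
  rw [map_one, Module.End.one_apply]

/-- **The closed-cell exponent is unramified when `d(𝒪ˣ, 1)` acts trivially on the Jacquet
module**: if `d(u,1)` (`|u| = 1`) acts as the identity on `I(σ)_N`, then `σ(proj d(u,1)) = 1` on `W`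
(compare `[I(d) f] = [f]` at `1` for `f` with `f(1) = w`: `f(d) = (σ∘proj ⊗ δ^{1/2})(d) w = w`).
(Jacquet–Langlands 1970, §3; Bump 1997, Thm. 4.6.4 context.) [cite: JacquetLanglands1970, Prop. 3.5] -/
theorem apply_leviProjection_diagGL2_eq_of_jacquetGL_eq (hσ : σ.IsSmooth) {u : Fˣ}
    (hu : valuation F (u : F) = 1)
    (htriv : ∀ x : (Representation.restrictUnipotentGL F (id : Fin 2 → Fin 2) (Representation.parabolicIndGL F (id : Fin 2 → Fin 2) σ)).Coinvariants, Representation.jacquetGL F (id : Fin 2 → Fin 2) (Representation.parabolicIndGL F (id : Fin 2 → Fin 2) σ)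
      (leviProjection F (id : Fin 2 → Fin 2) ⟨diagGL2 u 1, diagGL2_mem_standardParabolicGL_fin_two u 1⟩) x = x)
    (w : W) :
    σ (leviProjection F (id : Fin 2 → Fin 2) ⟨diagGL2 u 1, diagGL2_mem_standardParabolicGL_fin_two u 1⟩) w = w := by
  obtain ⟨hK₀o, hK₀c⟩ := isOpen_isCompact_comap_glInt_oppositeCellRadical (F := F)
  set f := (Representation.parabolicIndGL F (id : Fin 2 → Fin 2) σ) (permGL Fin.revPerm) (cellSection (Representation.twist (MonoidHom.comp σ (leviProjection F (id : Fin 2 → Fin 2))) (rootDeltaChar (standardParabolicGL F (id : Fin 2 → Fin 2)))) monotone_id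
    (hσ.twist_comp_leviProjection F (id : Fin 2 → Fin 2)) _ hK₀o hK₀c w) with hf_def
  have hf : f.toFun 1 = w := toFun_one_parabolicIndGL_permGL_cellSection σ hσ _ hK₀o hK₀c w
  have h := (jacquetGL_leviProjection_diagGL2_mk (π := (Representation.parabolicIndGL F (id : Fin 2 → Fin 2) σ)) u 1 f).symm.trans (htriv ((Representation.Coinvariants.mk (Representation.restrictUnipotentGL F (id : Fin 2 → Fin 2) (Representation.parabolicIndGL F (id : Fin 2 → Fin 2) σ))) f))
  have h2 := toFun_one_eq_of_mk_eq σ h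
  have h3 := toFun_one_parabolicIndGL_parabolic σ ⟨diagGL2 u 1, diagGL2_mem_standardParabolicGL_fin_two u 1⟩ f
  have h4 : (Representation.twist (MonoidHom.comp σ (leviProjection F (id : Fin 2 → Fin 2))) (rootDeltaChar (standardParabolicGL F (id : Fin 2 → Fin 2)))) ⟨diagGL2 u 1, diagGL2_mem_standardParabolicGL_fin_two u 1⟩ (f.toFun 1) = f.toFun 1 :=
    h3.symm.trans h2
  rwa [hf, Representation.twist_apply, rootDeltaChar_standardParabolicGL_eq_one_of_mem_glInt _
    (diagGL2_mem_glInt hu (by rw [Units.val_one, map_one])), Units.val_one, one_smul,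
    MonoidHom.comp_apply] at h4

set_option maxHeartbeats 400000 in
/-- **The open-cell exponent is unramified when `d(𝒪ˣ, 1)` acts trivially on a Jacquet module of
full dimension.**  Let `σ` act by scalars on `W ≠ 0` (a character), assume
`dim I(σ)_N = 2 · dim W` (so the open-cell classes `[Φ_{K₀,w}]` do not all vanish:
`dim ker ev̄ = dim W > 0`) and that `d(u,1)` (`|u| = 1`) acts as the identity on `I(σ)_N`.  Then
`σ(proj d(1,u)) = 1`: by `parabolicIndGL_diagGL2_cellSection`, `d(u,1)` multiplies a non-zero class
`[Φ_{K₀,w₁}]` by the scalar through which `σ(proj d(1,u))` acts.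
(Jacquet–Langlands 1970, Prop. 3.5 / §3; Bernstein–Zelevinsky 1977, Thm. 5.2.)
[cite: JacquetLanglands1970, Prop. 3.5] -/
theorem apply_leviProjection_diagGL2_swap_eq_of_jacquetGL_eq [FiniteDimensional ℂ W] [Nontrivial W]
    (hσ : σ.IsSmooth) (hscalar : ∀ t, ∃ c : ℂ, ∀ w : W, σ t w = c • w)
    (hdim : Module.finrank ℂ (Representation.restrictUnipotentGL F (id : Fin 2 → Fin 2) (Representation.parabolicIndGL F (id : Fin 2 → Fin 2) σ)).Coinvariants = 2 * Module.finrank ℂ W) {u : Fˣ} (hu : valuation F (u : F) = 1)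
    (htriv : ∀ x : (Representation.restrictUnipotentGL F (id : Fin 2 → Fin 2) (Representation.parabolicIndGL F (id : Fin 2 → Fin 2) σ)).Coinvariants, Representation.jacquetGL F (id : Fin 2 → Fin 2) (Representation.parabolicIndGL F (id : Fin 2 → Fin 2) σ)
      (leviProjection F (id : Fin 2 → Fin 2) ⟨diagGL2 u 1, diagGL2_mem_standardParabolicGL_fin_two u 1⟩) x = x)
    (w : W) :
    σ (leviProjection F (id : Fin 2 → Fin 2) ⟨diagGL2 1 u, diagGL2_mem_standardParabolicGL_fin_two 1 u⟩) w = w := by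
  obtain ⟨hK₀o, hK₀c⟩ := isOpen_isCompact_comap_glInt_oppositeCellRadical (F := F)
  set K₀ : Subgroup ↥(oppositeCellRadical (K := F) (id : Fin 2 → Fin 2)) :=
    (glInt 2 F).comap (oppositeCellRadical (K := F) (id : Fin 2 → Fin 2)).subtype with hK₀_def
  have hK₀ : ∀ x, x ∈ K₀ ↔ (x : GL (Fin 2) F) ∈ glInt 2 F := fun x => Iff.rfl
  have hτs := hσ.twist_comp_leviProjection F (id : Fin 2 → Fin 2)
  obtain ⟨evJ, hevJ⟩ := exists_coinvariants_eval σ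
  haveI hfd := (finiteDimensional_coinvariants_parabolicIndGL_fin_two σ hσ).1
  -- `ev̄` is onto, so `dim ker ev̄ = dim W > 0`
  have hrange : LinearMap.range evJ = ⊤ := by
    refine eq_top_iff.2 fun w' _ => ?_
    exact ⟨(Representation.Coinvariants.mk (Representation.restrictUnipotentGL F (id : Fin 2 → Fin 2) (Representation.parabolicIndGL F (id : Fin 2 → Fin 2) σ))) ((Representation.parabolicIndGL F (id : Fin 2 → Fin 2) σ) (permGL Fin.revPerm) (cellSection (Representation.twist (MonoidHom.comp σ (leviProjection F (id : Fin 2 → Fin 2))) (rootDeltaChar (standardParabolicGL F (id : Fin 2 → Fin 2)))) monotone_id hτs K₀ hK₀o hK₀c w')),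
      by rw [hevJ, toFun_one_parabolicIndGL_permGL_cellSection σ hσ]⟩
  have hker : Module.finrank ℂ (LinearMap.ker evJ) = Module.finrank ℂ W := by
    have h1 := LinearMap.finrank_range_add_finrank_ker evJ
    rw [hrange, finrank_top, hdim] at h1
    omega
  have hker0 : LinearMap.ker evJ ≠ ⊥ := by
    intro h
    rw [h, finrank_bot] at hker
    exact Module.finrank_pos.ne' hker.symm
  obtain ⟨x, hxker, hx0⟩ := (Submodule.ne_bot_iff _).1 hker0
  obtain ⟨w₁, hw₁⟩ := ker_eval_le_range σ hσ K₀ hK₀o hK₀c hevJ hxker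
  -- `d(u,1)` acts on `[Φ_{K₀,w₁}]` by the scalar of `σ(proj d(1,u))`
  obtain ⟨c, hc⟩ := hscalar (leviProjection F (id : Fin 2 → Fin 2)
    ⟨diagGL2 1 u, diagGL2_mem_standardParabolicGL_fin_two 1 u⟩)
  have hΦ := htriv x
  rw [← hw₁, LinearMap.comp_apply, cellSectionₗ_apply] at hΦ
  replace hΦ := (jacquetGL_leviProjection_diagGL2_mk (π := (Representation.parabolicIndGL F (id : Fin 2 → Fin 2) σ)) u 1 _).symm.trans hΦ
  rw [parabolicIndGL_diagGL2_cellSection σ hσ K₀ hK₀ hK₀o hK₀c hu, Representation.twist_apply,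
    rootDeltaChar_standardParabolicGL_eq_one_of_mem_glInt _ (diagGL2_mem_glInt (by rw [Units.val_one, map_one]) hu),
    Units.val_one, one_smul, MonoidHom.comp_apply, hc, ← cellSectionₗ_apply, map_smul, map_smul] at hΦ
  -- hence the scalar is `1`
  have hx : (Representation.Coinvariants.mk (Representation.restrictUnipotentGL F (id : Fin 2 → Fin 2) (Representation.parabolicIndGL F (id : Fin 2 → Fin 2) σ))) (cellSection (Representation.twist (MonoidHom.comp σ (leviProjection F (id : Fin 2 → Fin 2))) (rootDeltaChar (standardParabolicGL F (id : Fin 2 → Fin 2)))) monotone_id hτs K₀ hK₀o hK₀c w₁) = x := by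
    rw [← hw₁, LinearMap.comp_apply, cellSectionₗ_apply]
  rw [cellSectionₗ_apply, hx] at hΦ
  have hc1 : c = 1 := by
    have h : (c - 1) • x = 0 := by rw [sub_smul, one_smul, hΦ, sub_self]
    rcases smul_eq_zero.1 h with h | h
    · exact sub_eq_zero.1 h
    · exact absurd h hx0
  rw [hc, hc1, one_smul]

/-! ### Part 6: the spherical vector of an unramified principal series -/

omit [TopologicalSpace F] [IsNonarchimedeanLocalField F] in
/-- The diagonal entries of `p ∈ B ∩ GL₂(𝒪)` are units of `𝒪`. [folklore] -/
theorem valuation_apply_eq_one_of_mem_glInt (p : ↥(standardParabolicGL F (id : Fin 2 → Fin 2))) (hp : (p : GL (Fin 2) F) ∈ glInt 2 F) (i : Fin 2) :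
    valuation F (((p : GL (Fin 2) F) : Matrix (Fin 2) (Fin 2) F) i i) = 1 := by
  have h10 : ((p : GL (Fin 2) F) : Matrix (Fin 2) (Fin 2) F) 1 0 = 0 := p.2 (show (0 : Fin 2) < 1 by decide)
  have hdet : valuation F ((p : GL (Fin 2) F) : Matrix (Fin 2) (Fin 2) F).det = 1 :=
    valuation_det_eq_one_of_mem_glInt hp
  rw [Matrix.det_fin_two, h10, mul_zero, sub_zero, map_mul] at hdet
  have h0 := valuation_apply_le_one_of_mem_glInt hp 0 0
  have h1 := valuation_apply_le_one_of_mem_glInt hp 1 1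
  have h00 : valuation F (((p : GL (Fin 2) F) : Matrix (Fin 2) (Fin 2) F) 0 0) = 1 := by
    refine le_antisymm h0 ?_
    by_contra hlt
    rw [not_le] at hlt
    have := mul_lt_one_of_lt_of_le hlt h1
    rw [hdet] at this
    exact lt_irrefl _ this
  have h11 : valuation F (((p : GL (Fin 2) F) : Matrix (Fin 2) (Fin 2) F) 1 1) = 1 := by
    refine le_antisymm h1 ?_
    by_contra hlt
    rw [not_le] at hlt
    have := mul_lt_one_of_lt_of_le hlt h0
    rw [mul_comm, hdet] at this
    exact lt_irrefl _ this
  fin_cases i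
  · exact h00
  · exact h11

omit [ValuativeRel F] [TopologicalSpace F] [IsNonarchimedeanLocalField F] in
/-- **The Levi projection of `B ≤ GL₂` only sees the diagonal**: `proj p = proj d(p₀₀, p₁₁)`.
[folklore] -/
theorem leviProjection_eq_leviProjection_diagGL2 (p : ↥(standardParabolicGL F (id : Fin 2 → Fin 2)))
    (h0 : ((p : GL (Fin 2) F) : Matrix (Fin 2) (Fin 2) F) 0 0 ≠ 0)
    (h1 : ((p : GL (Fin 2) F) : Matrix (Fin 2) (Fin 2) F) 1 1 ≠ 0) :
    leviProjection F (id : Fin 2 → Fin 2) p = leviProjection F (id : Fin 2 → Fin 2)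
      ⟨diagGL2 (Units.mk0 _ h0) (Units.mk0 _ h1), diagGL2_mem_standardParabolicGL_fin_two _ _⟩ := by
  funext a
  refine Units.ext (Matrix.ext fun i j => ?_)
  obtain ⟨i, hi⟩ := i
  obtain ⟨j, hj⟩ := j
  have hi' : i = a := hi
  have hj' : j = a := hj
  simp only [leviProjection_apply_coe, coe_diagGL2]
  rw [show j = i from hj'.trans hi'.symm]
  fin_cases i <;> simp

omit [TopologicalSpace F] [IsNonarchimedeanLocalField F] in
/-- **An unramified datum is trivial on `B ∩ GL₂(𝒪)`**: if `σ(proj d(u,1)) = σ(proj d(1,u)) = 1` for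
all `|u| = 1`, then `σ(proj p) = 1` for every `p ∈ B ∩ GL₂(𝒪)`. [folklore] -/
theorem apply_leviProjection_eq_of_mem_glInt
    (h₁ : ∀ u : Fˣ, valuation F (u : F) = 1 → ∀ w : W,
      σ (leviProjection F (id : Fin 2 → Fin 2) ⟨diagGL2 u 1, diagGL2_mem_standardParabolicGL_fin_two u 1⟩) w = w)
    (h₂ : ∀ u : Fˣ, valuation F (u : F) = 1 → ∀ w : W,
      σ (leviProjection F (id : Fin 2 → Fin 2) ⟨diagGL2 1 u, diagGL2_mem_standardParabolicGL_fin_two 1 u⟩) w = w)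
    (p : ↥(standardParabolicGL F (id : Fin 2 → Fin 2))) (hp : (p : GL (Fin 2) F) ∈ glInt 2 F) (w : W) :
    σ (leviProjection F (id : Fin 2 → Fin 2) p) w = w := by
  have hv0 := valuation_apply_eq_one_of_mem_glInt p hp 0
  have hv1 := valuation_apply_eq_one_of_mem_glInt p hp 1
  have hne0 : ((p : GL (Fin 2) F) : Matrix (Fin 2) (Fin 2) F) 0 0 ≠ 0 := fun h => by
    rw [h, map_zero] at hv0; exact zero_ne_one hv0
  have hne1 : ((p : GL (Fin 2) F) : Matrix (Fin 2) (Fin 2) F) 1 1 ≠ 0 := fun h => by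
    rw [h, map_zero] at hv1; exact zero_ne_one hv1
  rw [leviProjection_eq_leviProjection_diagGL2 p hne0 hne1]
  have hsplit : (⟨diagGL2 (Units.mk0 _ hne0) (Units.mk0 _ hne1), diagGL2_mem_standardParabolicGL_fin_two _ _⟩ : ↥(standardParabolicGL F (id : Fin 2 → Fin 2))) =
      ⟨diagGL2 (Units.mk0 _ hne0) 1, diagGL2_mem_standardParabolicGL_fin_two _ _⟩ *
        ⟨diagGL2 1 (Units.mk0 _ hne1), diagGL2_mem_standardParabolicGL_fin_two _ _⟩ := by
    refine Subtype.ext ?_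
    change diagGL2 _ _ = diagGL2 _ _ * diagGL2 _ _
    rw [← diagGL2_mul, mul_one, one_mul]
  rw [hsplit, map_mul, map_mul, Module.End.mul_apply, h₂ _ hv1, h₁ _ hv0]

/-- **The spherical vector of an unramified principal series of `GL₂`.**  If the inducing datum
`σ` is trivial on the Levi projections of `B ∩ GL₂(𝒪)` (e.g. an unramified character) and
`W ≠ 0`, then `I(σ)` has a non-zero `GL₂(𝒪)`-fixed vector: the function `f₀(b k) = (σ∘proj ⊗
δ^{1/2})(b) w₀` (`b ∈ B`, `k ∈ GL₂(𝒪)`, Iwasawa decomposition `exists_borel_mul_glInt`), well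
defined because `σ ∘ proj ⊗ δ^{1/2}` is trivial on `B ∩ GL₂(𝒪)` (`δ^{1/2}` by compactness).
(Bump 1997, Prop. 4.6.2 / Thm. 4.6.4; Casselman 1980, §3; Cartier 1979, §IV.) [cite: Bump1997, Thm. 4.6.4] -/
theorem exists_mem_fixedPoints_glInt_parabolicIndGL_fin_two [Nontrivial W]
    (htriv : ∀ p : ↥(standardParabolicGL F (id : Fin 2 → Fin 2)), (p : GL (Fin 2) F) ∈ glInt 2 F → ∀ w : W,
      σ (leviProjection F (id : Fin 2 → Fin 2) p) w = w) :
    ∃ f : Representation.SmoothInd (standardParabolicGL F (id : Fin 2 → Fin 2)) (Representation.twist (MonoidHom.comp σ (leviProjection F (id : Fin 2 → Fin 2))) (rootDeltaChar (standardParabolicGL F (id : Fin 2 → Fin 2)))), f ≠ 0 ∧ f ∈ (Representation.parabolicIndGL F (id : Fin 2 → Fin 2) σ).fixedPoints (glInt 2 F) := by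
  classical
  obtain ⟨w₀, hw₀⟩ := exists_ne (0 : W)
  have hτK : ∀ p : ↥(standardParabolicGL F (id : Fin 2 → Fin 2)), (p : GL (Fin 2) F) ∈ glInt 2 F → (Representation.twist (MonoidHom.comp σ (leviProjection F (id : Fin 2 → Fin 2))) (rootDeltaChar (standardParabolicGL F (id : Fin 2 → Fin 2)))) p w₀ = w₀ := fun p hp => by
    rw [Representation.twist_apply, rootDeltaChar_standardParabolicGL_eq_one_of_mem_glInt p hp, Units.val_one,
      one_smul, MonoidHom.comp_apply, htriv p hp]
  -- a chosen Iwasawa decomposition `x = b(x) k(x)`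
  have hdec : ∀ x : GL (Fin 2) F, ∃ (b : ↥(standardParabolicGL F (id : Fin 2 → Fin 2))) (k : GL (Fin 2) F), k ∈ glInt 2 F ∧ x = b * k := fun x => by
    obtain ⟨b, hb, k, hk, rfl⟩ := exists_borel_mul_glInt x
    exact ⟨⟨b, hb⟩, k, hk, rfl⟩
  choose bb kk hkk hx using hdec
  -- two decompositions give the same value of `τ(b) w₀`
  have hkey : ∀ (b b' : ↥(standardParabolicGL F (id : Fin 2 → Fin 2))) (k k' : GL (Fin 2) F), k ∈ glInt 2 F → k' ∈ glInt 2 F →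
      (b : GL (Fin 2) F) * k = b' * k' → (Representation.twist (MonoidHom.comp σ (leviProjection F (id : Fin 2 → Fin 2))) (rootDeltaChar (standardParabolicGL F (id : Fin 2 → Fin 2)))) b w₀ = (Representation.twist (MonoidHom.comp σ (leviProjection F (id : Fin 2 → Fin 2))) (rootDeltaChar (standardParabolicGL F (id : Fin 2 → Fin 2)))) b' w₀ := by
    intro b b' k k' hk hk' he
    have hmem : ((b'⁻¹ * b : ↥(standardParabolicGL F (id : Fin 2 → Fin 2))) : GL (Fin 2) F) ∈ glInt 2 F := by
      have h' : ((b'⁻¹ * b : ↥(standardParabolicGL F (id : Fin 2 → Fin 2))) : GL (Fin 2) F) = k' * k⁻¹ := by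
        rw [Subgroup.coe_mul, Subgroup.coe_inv]
        calc ((b' : GL (Fin 2) F))⁻¹ * b = (b' : GL (Fin 2) F)⁻¹ * ((b : GL (Fin 2) F) * k) * k⁻¹ := by group
          _ = (b' : GL (Fin 2) F)⁻¹ * ((b' : GL (Fin 2) F) * k') * k⁻¹ := by rw [he]
          _ = k' * k⁻¹ := by group
      rw [h']
      exact Subgroup.mul_mem _ hk' (Subgroup.inv_mem _ hk)
    calc (Representation.twist (MonoidHom.comp σ (leviProjection F (id : Fin 2 → Fin 2))) (rootDeltaChar (standardParabolicGL F (id : Fin 2 → Fin 2)))) b w₀ = (Representation.twist (MonoidHom.comp σ (leviProjection F (id : Fin 2 → Fin 2))) (rootDeltaChar (standardParabolicGL F (id : Fin 2 → Fin 2)))) b' ((Representation.twist (MonoidHom.comp σ (leviProjection F (id : Fin 2 → Fin 2))) (rootDeltaChar (standardParabolicGL F (id : Fin 2 → Fin 2)))) (b'⁻¹ * b) w₀) := by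
          rw [← Module.End.mul_apply, ← map_mul, mul_inv_cancel_left]
      _ = (Representation.twist (MonoidHom.comp σ (leviProjection F (id : Fin 2 → Fin 2))) (rootDeltaChar (standardParabolicGL F (id : Fin 2 → Fin 2)))) b' w₀ := by rw [hτK _ hmem]
  -- the function `f₀(x) = τ(b(x)) w₀`
  set Fw : GL (Fin 2) F → W := fun x => (Representation.twist (MonoidHom.comp σ (leviProjection F (id : Fin 2 → Fin 2))) (rootDeltaChar (standardParabolicGL F (id : Fin 2 → Fin 2)))) (bb x) w₀ with hFw
  have hF_left : ∀ (b : ↥(standardParabolicGL F (id : Fin 2 → Fin 2))) (x : GL (Fin 2) F), Fw (b * x) = (Representation.twist (MonoidHom.comp σ (leviProjection F (id : Fin 2 → Fin 2))) (rootDeltaChar (standardParabolicGL F (id : Fin 2 → Fin 2)))) b (Fw x) := by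
    intro b x
    have he : ((bb ((b : GL (Fin 2) F) * x) : ↥(standardParabolicGL F (id : Fin 2 → Fin 2))) : GL (Fin 2) F) * kk ((b : GL (Fin 2) F) * x) =
        ((b * bb x : ↥(standardParabolicGL F (id : Fin 2 → Fin 2))) : GL (Fin 2) F) * kk x := by
      rw [← hx ((b : GL (Fin 2) F) * x), Subgroup.coe_mul, mul_assoc, ← hx x]
    change (Representation.twist (MonoidHom.comp σ (leviProjection F (id : Fin 2 → Fin 2))) (rootDeltaChar (standardParabolicGL F (id : Fin 2 → Fin 2)))) (bb ((b : GL (Fin 2) F) * x)) w₀ = (Representation.twist (MonoidHom.comp σ (leviProjection F (id : Fin 2 → Fin 2))) (rootDeltaChar (standardParabolicGL F (id : Fin 2 → Fin 2)))) b ((Representation.twist (MonoidHom.comp σ (leviProjection F (id : Fin 2 → Fin 2))) (rootDeltaChar (standardParabolicGL F (id : Fin 2 → Fin 2)))) (bb x) w₀)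
    rw [hkey _ _ _ _ (hkk _) (hkk x) he, map_mul, Module.End.mul_apply]
  have hF_right : ∀ (x k : GL (Fin 2) F), k ∈ glInt 2 F → Fw (x * k) = Fw x := by
    intro x k hk
    have he : ((bb (x * k) : ↥(standardParabolicGL F (id : Fin 2 → Fin 2))) : GL (Fin 2) F) * kk (x * k) = (bb x : GL (Fin 2) F) * (kk x * k) := by
      rw [← hx (x * k), ← mul_assoc, ← hx x]
    change (Representation.twist (MonoidHom.comp σ (leviProjection F (id : Fin 2 → Fin 2))) (rootDeltaChar (standardParabolicGL F (id : Fin 2 → Fin 2)))) (bb (x * k)) w₀ = (Representation.twist (MonoidHom.comp σ (leviProjection F (id : Fin 2 → Fin 2))) (rootDeltaChar (standardParabolicGL F (id : Fin 2 → Fin 2)))) (bb x) w₀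
    exact hkey _ _ _ _ (hkk _) (Subgroup.mul_mem _ (hkk x) hk) he
  have hF_one : Fw 1 = w₀ := by
    have he : ((bb 1 : ↥(standardParabolicGL F (id : Fin 2 → Fin 2))) : GL (Fin 2) F) * kk 1 = ((1 : ↥(standardParabolicGL F (id : Fin 2 → Fin 2))) : GL (Fin 2) F) * 1 := by
      rw [← hx 1, Subgroup.coe_one, one_mul]
    change (Representation.twist (MonoidHom.comp σ (leviProjection F (id : Fin 2 → Fin 2))) (rootDeltaChar (standardParabolicGL F (id : Fin 2 → Fin 2)))) (bb 1) w₀ = w₀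
    rw [hkey _ _ _ _ (hkk 1) (Subgroup.one_mem _) he, map_one, Module.End.one_apply]
  -- `f₀ ∈ Ind`, `GL₂(𝒪)`-fixed, hence smooth
  have hF_mem : Fw ∈ Representation.coindV (Subgroup.subtype (standardParabolicGL F (id : Fin 2 → Fin 2))) (Representation.twist (MonoidHom.comp σ (leviProjection F (id : Fin 2 → Fin 2))) (rootDeltaChar (standardParabolicGL F (id : Fin 2 → Fin 2)))) :=
    (Representation.mem_indFun_iff (standardParabolicGL F (id : Fin 2 → Fin 2)) (Representation.twist (MonoidHom.comp σ (leviProjection F (id : Fin 2 → Fin 2))) (rootDeltaChar (standardParabolicGL F (id : Fin 2 → Fin 2)))) _).2 fun b x => hF_left b x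
  have hF_fix : (⟨Fw, hF_mem⟩ : Representation.coindV (Subgroup.subtype (standardParabolicGL F (id : Fin 2 → Fin 2))) (Representation.twist (MonoidHom.comp σ (leviProjection F (id : Fin 2 → Fin 2))) (rootDeltaChar (standardParabolicGL F (id : Fin 2 → Fin 2))))) ∈
      (Representation.indFun (standardParabolicGL F (id : Fin 2 → Fin 2)) (Representation.twist (MonoidHom.comp σ (leviProjection F (id : Fin 2 → Fin 2))) (rootDeltaChar (standardParabolicGL F (id : Fin 2 → Fin 2))))).fixedPoints (glInt 2 F) := by
    rw [Representation.mem_fixedPoints]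
    intro κ hκ
    refine Subtype.ext (funext fun x => ?_)
    exact hF_right x κ hκ
  have hF_smooth : (Representation.indFun (standardParabolicGL F (id : Fin 2 → Fin 2)) (Representation.twist (MonoidHom.comp σ (leviProjection F (id : Fin 2 → Fin 2))) (rootDeltaChar (standardParabolicGL F (id : Fin 2 → Fin 2))))).IsSmoothVector
      (⟨Fw, hF_mem⟩ : Representation.coindV (Subgroup.subtype (standardParabolicGL F (id : Fin 2 → Fin 2))) (Representation.twist (MonoidHom.comp σ (leviProjection F (id : Fin 2 → Fin 2))) (rootDeltaChar (standardParabolicGL F (id : Fin 2 → Fin 2))))) :=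
    (Representation.indFun (standardParabolicGL F (id : Fin 2 → Fin 2)) (Representation.twist (MonoidHom.comp σ (leviProjection F (id : Fin 2 → Fin 2))) (rootDeltaChar (standardParabolicGL F (id : Fin 2 → Fin 2))))).isSmoothVector_of_mem_fixedPoints (isOpen_glInt 2 F) hF_fix
  let f₀ : Representation.SmoothInd (standardParabolicGL F (id : Fin 2 → Fin 2)) (Representation.twist (MonoidHom.comp σ (leviProjection F (id : Fin 2 → Fin 2))) (rootDeltaChar (standardParabolicGL F (id : Fin 2 → Fin 2)))) :=
    show ↥(Representation.smoothInd (standardParabolicGL F (id : Fin 2 → Fin 2)) (Representation.twist (MonoidHom.comp σ (leviProjection F (id : Fin 2 → Fin 2))) (rootDeltaChar (standardParabolicGL F (id : Fin 2 → Fin 2))))).toSubmodule from ⟨⟨Fw, hF_mem⟩, hF_smooth⟩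
  have hf₀ : ∀ x, f₀.toFun x = Fw x := fun _ => rfl
  refine ⟨f₀, fun h0 => hw₀ ?_, ?_⟩
  · rw [← hF_one, ← hf₀, h0]
    rfl
  · rw [Representation.mem_fixedPoints]
    intro κ hκ
    refine Representation.SmoothInd.ext (funext fun x => ?_)
    rw [parabolicIndGL_fin_two_apply, Representation.toFun_smoothIndRep_apply, hf₀, hf₀]
    exact hF_right x κ hκ

end PrincipalSeries

end Literature.NumberTheory.Automorphic

end
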